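import Literature.NumberTheory.EllipticCurves.ModSevenImageSplitCartanJLine
import HarnessLib

/-!
# Zywina's `j`-line criteria for a small mod-`3` / mod-`5` image: `N_s(3)`, `N_ns(3)`, `N_s(5)` and the
# exceptional maximal subgroup `G₉ ⊃ N_s(5)` of `GL₂(𝔽₅)` (companion of `ModSevenImageSplitCartanJLine`)

D. Zywina, *On the possible images of the mod ℓ representations associated to elliptic curves over ℚ*,
arXiv:1508.07660 (2015), §1.2 (ℓ = 3: groups `G₁…G₄`, rational functions `J₁…J₄`, Theorem 1.2) and §1.3
(ℓ = 5: groups `G₁…G₉`, rational functions `J₁…J₉`, Theorem 1.4). For an applicable subgroup `G` (i.e.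
`−I ∈ G`, `det G = 𝔽_ℓ^×`) of genus `0` the modular curve `X_G ≅ ℙ¹` has `j`-map `J_G ∈ ℚ(t)`, and for a
non-CM `E/ℚ`: `ρ_{E,ℓ}(Gal_ℚ)` is conjugate to a subgroup of `G` iff `j_E = J_G(t)` for some `t ∈ ℚ`
(p. 3: "the group `ρ_{E,ℓ}(Gal_ℚ)` is conjugate in `GL₂(𝔽_ℓ)` to subgroup of `G` if and only if the
`j_E = π_G(P)` for some rational point `P ∈ X_G(ℚ)`"). Vendored here, exactly as the tree's
`zywina2015_thm15_not_surjective_seven_of_j_eq_J2` (ℓ = 7, `N_s(7)`): the «if» direction of the second item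
of Theorems 1.2 / 1.4 for the four groups met by the BSD residual census (Cremona/Sutherland labels `3Ns`,
`3Nn`, `5Ns`, `5S4`), WEAKENED to non-surjectivity of `ρ̄_{E,ℓ}` (each group is a proper subgroup: indices
`6`, `3`, `15`, `5`), with the `j`-identity cleared of denominators. Named facts (`Prop`s; nothing asserted);
consumers take them as hypotheses (the certificate records of `Summits/…/Rank1Residual/X9/PrintCert*` carry
the parameter `t` and recheck the `j`-identity in the kernel).
-- TODO(general form): the printed statements are «conjugate to a subgroup of G_i» and «iff»; the tree has no
-- vocabulary yet for conjugacy classes of subgroups of `Aut(W[ℓ]) ≅ GL₂(𝔽_ℓ)`, so only non-surjectivity is recorded.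
-/

namespace Literature.NumberTheory.EllipticCurves

open scoped Classical
open WeierstrassCurve Literature.NumberTheory.EllipticCurves

/-- **Zywina 2015, Theorem 1.2 (ℓ = 3), second item for `i = 2` (`G₂ = N_s(3)`), the «if» direction weakened to
non-surjectivity.** As printed (arXiv:1508.07660, §1.2 and Thm. 1.2): "Let `G₂` be the group `N_s(3)`. … The
index in `GL₂(𝔽₃)` of the above subgroups are `12`, `6`, `4`, `3`, `24`, `8` and `8`, respectively. Each of the
groups `G_i` contain `−I`. … `J₂(t) = 27(t+1)³(t−3)³/t³` … Theorem 1.2. Let `E` be a non-CM elliptic curve over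
`ℚ`. … • The group `ρ_{E,3}(Gal_ℚ)` is conjugate to a subgroup of `G_i` if and only if `j_E` is of the form
`J_i(t)` for some `t ∈ ℚ`." Vendored SPECIAL CASE: for `W/ℚ` elliptic and non-CM and `t ∈ ℚ` with `t ≠ 0` and
`j(W)·t³ = 27(t+1)³(t−3)³` (i.e. `j(W) = J₂(t)`), the mod-`3` representation `ρ̄_{W,3}` is NOT surjective
(`N_s(3)` has index `6` in `GL₂(𝔽₃)`). Named fact; nothing asserted. Size L (the modular curve `X_{N_s(3)}`).
[cite: Zywina2015, Thm. 1.2 (second item, i = 2) and §1.2 (G₂ = N_s(3), J₂) (arXiv:1508.07660 pp. 3–4)] -/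
def zywina2015_thm12_not_surjective_three_of_j_eq_J2 : Prop :=
  ∀ (W : WeierstrassCurve ℚ) [W.IsElliptic], ¬ W.HasCM → ∀ t : ℚ, t ≠ 0 →
    W.j * t ^ 3 = 27 * (t + 1) ^ 3 * (t - 3) ^ 3 → ¬ W.HasSurjectiveModNGaloisRep 3

/-- **Zywina 2015, Theorem 1.2 (ℓ = 3), second item for `i = 4` (`G₄ = N_ns(3)`), the «if» direction weakened to
non-surjectivity.** As printed (§1.2 and Thm. 1.2): "Let `G₄` be the group `N_{ns}(3)`. … `J₄(t) = t³`. … • The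
group `ρ_{E,3}(Gal_ℚ)` is conjugate to a subgroup of `G_i` if and only if `j_E` is of the form `J_i(t)` for some
`t ∈ ℚ`." Vendored SPECIAL CASE: for `W/ℚ` elliptic and non-CM and `t ∈ ℚ` with `j(W) = t³`, `ρ̄_{W,3}` is NOT
surjective (`N_ns(3)` has index `3` in `GL₂(𝔽₃)`). Named fact; nothing asserted. Size L.
[cite: Zywina2015, Thm. 1.2 (second item, i = 4) and §1.2 (G₄ = N_ns(3), J₄) (arXiv:1508.07660 pp. 3–4)] -/
def zywina2015_thm12_not_surjective_three_of_j_eq_J4 : Prop :=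
  ∀ (W : WeierstrassCurve ℚ) [W.IsElliptic], ¬ W.HasCM → ∀ t : ℚ,
    W.j = t ^ 3 → ¬ W.HasSurjectiveModNGaloisRep 3

/-- **Zywina 2015, Theorem 1.4 (ℓ = 5), second item for `i = 4` (`G₄ = N_s(5)`), the «if» direction weakened to
non-surjectivity.** As printed (§1.3 and Thm. 1.4): "Let `G₄` be the group `N_s(5)`. … The index in `GL₂(𝔽₅)`
of the above subgroups are `60`, `30`, `30`, `15`, `12`, `12`, `10`, `6`, `5`, …, respectively. Each of the groups
`G_i` contain `−I`. … `J₄(t) = (t+5)³(t²−5)³(t²+5t+10)³/(t²+5t+5)⁵` … Theorem 1.4. Let `E` be a non-CM elliptic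
curve over `ℚ`. … • The group `ρ_{E,5}(Gal_ℚ)` is conjugate to a subgroup of `G_i` if and only if `j_E` is of
the form `J_i(t)` for some `t ∈ ℚ`." Vendored SPECIAL CASE: for `W/ℚ` elliptic and non-CM and `t ∈ ℚ` with
`t²+5t+5 ≠ 0` and `j(W)·(t²+5t+5)⁵ = (t+5)³(t²−5)³(t²+5t+10)³` (i.e. `j(W) = J₄(t)`), `ρ̄_{W,5}` is NOT
surjective (`N_s(5)` has index `15` in `GL₂(𝔽₅)`). Named fact; nothing asserted. Size L.
[cite: Zywina2015, Thm. 1.4 (second item, i = 4) and §1.3 (G₄ = N_s(5), J₄) (arXiv:1508.07660 pp. 4–5)] -/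
def zywina2015_thm14_not_surjective_five_of_j_eq_J4 : Prop :=
  ∀ (W : WeierstrassCurve ℚ) [W.IsElliptic], ¬ W.HasCM → ∀ t : ℚ, t ^ 2 + 5 * t + 5 ≠ 0 →
    W.j * (t ^ 2 + 5 * t + 5) ^ 5 = (t + 5) ^ 3 * (t ^ 2 - 5) ^ 3 * (t ^ 2 + 5 * t + 10) ^ 3 →
    ¬ W.HasSurjectiveModNGaloisRep 5

/-- **Zywina 2015, Theorem 1.4 (ℓ = 5), second item for `i = 9` (`G₉` = the unique maximal subgroup of
`GL₂(𝔽₅)` containing `N_s(5)`, image `𝔖₄` in `PGL₂(𝔽₅)`), the «if» direction weakened to non-surjectivity.**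
As printed (§1.3 and Thm. 1.4): "Let `G₉` be the unique maximal subgroup of `GL₂(𝔽₅)` which contains `N_s(5)`;
it is generated by `(2 0; 0 1)`, `(1 0; 0 2)`, `(0 −1; 1 0)` and `(1 1; 1 −1)`. … [index] `5` … `J₉(t) = t³(t²+5t+40)`
… • The group `ρ_{E,5}(Gal_ℚ)` is conjugate to a subgroup of `G_i` if and only if `j_E` is of the form `J_i(t)`
for some `t ∈ ℚ`." Vendored SPECIAL CASE: for `W/ℚ` elliptic and non-CM and `t ∈ ℚ` with
`j(W) = t³(t²+5t+40)`, `ρ̄_{W,5}` is NOT surjective (`G₉` has index `5` in `GL₂(𝔽₅)`). Named fact; nothing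
asserted. Size L.
[cite: Zywina2015, Thm. 1.4 (second item, i = 9) and §1.3 (G₉, J₉) (arXiv:1508.07660 pp. 4–5)] -/
def zywina2015_thm14_not_surjective_five_of_j_eq_J9 : Prop :=
  ∀ (W : WeierstrassCurve ℚ) [W.IsElliptic], ¬ W.HasCM → ∀ t : ℚ,
    W.j = t ^ 3 * (t ^ 2 + 5 * t + 40) → ¬ W.HasSurjectiveModNGaloisRep 5

end Literature.NumberTheory.EllipticCurves
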